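import Summits.CriticalPhenomena.PercolationContinuityZ3.Theorems.Transplant.PlanarSkeletonFrmDefs
import Literature.Probability.Percolation.PlacedBricks
import Literature.Probability.Percolation.HalfSpaceBrickSymmetry
import HarnessLib

/-!
# N2 (frames-only node, OPEN), ORIENTED route design (N2-SCOPE §17 (R-12) FINAL; typed p3-g13, filed p3-g14): **coordinate reflections of a frames-only skeleton** — `PlanarSkeletonFrm.reflect s`
# (`φ ↦ (s₀·φ₀, s₁·φ₁)`, `s : Fin 2 → ℤˣ`): frames, Lipschitz, steps, cylinders and Φ2 are invariant under coordinate sign changes, so the GLOBAL CHART FLIP of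
# N2-SCOPE v1 (R-2) (normalising the cofinal physical colour to (east, north)) is a map `PlanarSkeletonFrm G → PlanarSkeletonFrm G` preserving `types`, `cyl`
# and `CylSubcritical` — the node's hypotheses and conclusion are untouched.
builds on p205010 (kernel theorem, internal audit signed; external expert review pending) — nothing here uses p205010; nothing is claimed about any node. [this work]
-/

noncomputable section

namespace Summit.CriticalPhenomena.PercolationContinuityZ3.Theorems.Transplant

open Literature.Probability.Percolation Literature.Probability.LatticeModels SimpleGraph
open scoped Classical

namespace PlanarSkeletonFrm

variable {V : Type} {G : SimpleGraph V} [G.LocallyFinite] (Φ : PlanarSkeletonFrm G)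

/-- Sign-changing coordinates preserves membership in a box. [folklore] -/
theorem smul_mem_box_iff (s : Fin 2 → ℤˣ) (x : Site 2) (ℓ : ℕ) : (fun i => (s i : ℤ) * x i) ∈ box 2 ℓ ↔ x ∈ box 2 ℓ := by
  simp only [mem_box]
  refine forall_congr' fun i => ?_
  rw [← abs_le, ← abs_le, Literature.Probability.Percolation.BGN.abs_units_mul]

/-- **The reflected skeleton** `φ ↦ (s₀φ₀, s₁φ₁)`: still a `PlanarSkeletonFrm` (same types, frames, degree bound; steps re-signed; cylinders equal as sets). [this work] -/
def reflect (s : Fin 2 → ℤˣ) : PlanarSkeletonFrm G where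
  φ := fun w i => (s i : ℤ) * Φ.φ w i
  lip := by
    intro u v huv i
    have := Φ.lip huv i
    rw [← mul_sub, Literature.Probability.Percolation.BGN.abs_units_mul]; exact this
  types := Φ.types
  frame := by
    intro v
    obtain ⟨t, ht, α, hαt, hα⟩ := Φ.frame v
    refine ⟨t, ht, α, hαt, fun w => ?_⟩
    ext i
    simp only [Pi.add_apply, Pi.sub_apply, hα w]
    ring
  Δ := Φ.Δ
  degree_le := Φ.degree_le
  step := by
    intro v i σ
    obtain ⟨v', hadj, hφ⟩ := Φ.step v i (σ * s i)
    refine ⟨v', hadj, ?_⟩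
    ext j
    rw [Pi.add_apply, hφ, Pi.add_apply, mul_add]
    congr 1
    by_cases hj : j = i
    · subst hj
      rw [Pi.single_eq_same, Pi.single_eq_same, Units.val_mul]
      have := Literature.Probability.Percolation.BGN.units_mul_self (s j)
      calc (s j : ℤ) * (σ * s j) = σ * ((s j : ℤ) * s j) := by ring
        _ = σ := by rw [this, mul_one]
    · rw [Pi.single_eq_of_ne hj, Pi.single_eq_of_ne hj, mul_zero]
  cyl_connected := by
    intro t ht ℓ hℓ
    have hset : {w : V | (fun i => (s i : ℤ) * Φ.φ w i) - (fun i => (s i : ℤ) * Φ.φ t i) ∈ box 2 ℓ} = {w : V | Φ.φ w - Φ.φ t ∈ box 2 ℓ} := by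
      ext w
      simp only [Set.mem_setOf_eq]
      have e : ((fun i => (s i : ℤ) * Φ.φ w i) - fun i => (s i : ℤ) * Φ.φ t i) = fun i => (s i : ℤ) * (Φ.φ w - Φ.φ t) i := by
        ext i; simp only [Pi.sub_apply]; ring
      rw [e, smul_mem_box_iff]
    rw [hset]
    exact Φ.cyl_connected t ht ℓ hℓ

/-- The reflected skeleton has the same base vertices. [folklore] -/
@[simp] theorem reflect_types (s : Fin 2 → ℤˣ) : (Φ.reflect s).types = Φ.types := rfl

/-- The reflected chart, unfolded. [folklore] -/
@[simp] theorem reflect_φ (s : Fin 2 → ℤˣ) (w : V) (i : Fin 2) : (Φ.reflect s).φ w i = (s i : ℤ) * Φ.φ w i := rfl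

/-- The reflected skeleton has the same cylinders. [folklore] -/
theorem reflect_cyl (s : Fin 2 → ℤˣ) (t : V) (ℓ : ℕ) : (Φ.reflect s).cyl t ℓ = Φ.cyl t ℓ := by
  ext w
  simp only [cyl, Set.mem_setOf_eq]
  have e : ((Φ.reflect s).φ w - (Φ.reflect s).φ t) = fun i => (s i : ℤ) * (Φ.φ w - Φ.φ t) i := by
    ext i; simp only [Pi.sub_apply, reflect_φ]; ring
  rw [e, smul_mem_box_iff]

/-- **Φ2 is invariant under coordinate reflections.** [folklore] -/
theorem reflect_cylSubcritical_iff (s : Fin 2 → ℤˣ) (p : unitInterval) : (Φ.reflect s).CylSubcritical p ↔ Φ.CylSubcritical p := by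
  unfold CylSubcritical
  refine forall₂_congr fun t _ => forall_congr' fun ℓ => ?_
  have hS : (Φ.reflect s).cyl t ℓ = Φ.cyl t ℓ := Φ.reflect_cyl s t ℓ
  constructor
  · intro h
    have key : ∀ (S S' : Set V) (e : S = S') (hm : t ∈ S) (hm' : t ∈ S'),
        theta (G.induce S) ⟨t, hm⟩ p = theta (G.induce S') ⟨t, hm'⟩ p := by
      intro S S' e hm hm'; subst e; rfl
    rw [← key _ _ hS]; exact h
  · intro h
    have key : ∀ (S S' : Set V) (e : S = S') (hm : t ∈ S) (hm' : t ∈ S'),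
        theta (G.induce S) ⟨t, hm⟩ p = theta (G.induce S') ⟨t, hm'⟩ p := by
      intro S S' e hm hm'; subst e; rfl
    rw [key _ _ hS]; exact h

/-- Relative coordinates of the reflected chart: `φˢ w − φˢ t = (sᵢ·(φ w − φ t)ᵢ)ᵢ`. [folklore] -/
theorem reflect_sub (s : Fin 2 → ℤˣ) (w t : V) (i : Fin 2) : (Φ.reflect s).φ w i - (Φ.reflect s).φ t i = (s i : ℤ) * (Φ.φ w i - Φ.φ t i) := by
  simp only [reflect_φ]; ring

end PlanarSkeletonFrm

end Summit.CriticalPhenomena.PercolationContinuityZ3.Theorems.Transplant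

end
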